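import Literature.Geometry.Kaehler.HolomorphicChainLimitCone
import Literature.Geometry.Kaehler.AnalyticSetHausdorffNull
import Mathlib.Analysis.Normed.Module.Connected

/-!
# Structure of the limit cone: regular part, null bad set, finitely many conic components

Let `A ⊆ Ω ⊆ V` be an analytic set of pure dimension `p` in a finite-dimensional complex inner
product space, `b ∈ Ω`, and `F = limitCone A hb ⊆ V` the limit cone of `A` at `b`
(`AnalyticSetDeformation.lean`: a closed analytic cone of dimension `≤ p` containing all limits of
blow-up directions). Viewing `F` in the complex manifold `⊤ : Opens V` (`limitConeTop`), this file
records the structure used to build the tangent-cone chain of King's theorem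
(`Literature.Geometry.Kaehler.King1971_tangentCone`):

* `limitConeReg A hb p` — the set `M` of regular points of `F` of dimension `p`
  (`regularLocusOfCodim … (dim V − p)`), relatively open in `F`; `limitConeBad` — its complement
  `F ∖ M`, closed, and **`μHE[2p]`-null** (`euclideanHausdorffMeasure_image_limitConeBad_eq_zero`:
  it consists of singular points of `F` and of regular points of dimension `< p`,
  [Chirka1989, §3.7 Cor., §5.2]);
* `euclideanHausdorffMeasure_limitCone_inter_lt_top` — **`𝓗^{2p}(F ∩ K) < ∞`** for compact `K`
  (Lelong's theorem on the pure `p`-dimensional part `cl M`, [Chirka1989, §14.1]);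
* `limitConeComp A hb y`, `limitConeIrr A hb y` — the connected component of `reg F` through
  `y ∈ M` and its closure: an **irreducible analytic cone of pure dimension `p`**
  (`isIrreducibleAnalyticSet_limitConeIrr`, `hasPureDim_limitConeIrr`, `topSmul_mem_limitConeComp`,
  `topSmul_mem_limitConeIrr`, `zero_mem_limitConeIrr` — invariance under `y ↦ c • y`, `c ≠ 0`, by
  connectedness of `ℂ ∖ {0}`), near points of which `F` coincides with the component
  (`exists_isOpen_limitConeTop_inter_eq`); a component met by the closure of another equals it
  (`limitConeComp_eq_of_limitConeIrr_inter_nonempty`); and **there are finitely many of them**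
  (`finite_setOf_limitConeComp`: every component meets the unit ball, [Chirka1989, §5.1 Thm. (1)]).

Definitions + theorems; no named facts (the deep inputs are the discharged facts of
`AnalyticSet*.lean`, `IrreducibleComponents*.lean` and `Lelong1957_hausdorffMeasure_inter_lt_top_holds`).

## References

* E. M. Chirka, *Complex Analytic Sets*, Kluwer 1989, §5.1–5.4, §8.1–8.3, §14.1 [Chirka1989].
* R. Harvey, *Holomorphic chains and their boundaries*, PSPUM XXX.1 (1977), §1.10 [Harvey1977].
-/

open scoped Manifold Topology Pointwise ENNReal
open Set Filter Function TopologicalSpace Metric MeasureTheory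

namespace Literature.Geometry.Kaehler

open SCV Literature.Analysis.Complex.SCV

universe u

variable {V : Type u} [NormedAddCommGroup V] [InnerProductSpace ℂ V] [FiniteDimensional ℂ V]

/-! ### Regular points are preserved by dilations of an invariant set (model space) -/

section SmulModel

variable {W : Type*} [NormedAddCommGroup W] [NormedSpace ℂ W]

/-- **Dilations preserve regularity of an invariant set**: if `S ⊆ W` is invariant under `x ↦ c • x`
and `x ↦ c⁻¹ • x` (`c ≠ 0`) and `x` is a regular point of `S` of codimension `q`, so is `c • x`
(compose the defining submersion with `c⁻¹ •`). [folklore] -/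
theorem SCV.IsRegPt.smul_of_invariant {S : Set W} {c : ℂ} (hc : c ≠ 0)
    (hS : ∀ x ∈ S, c • x ∈ S) (hS' : ∀ x ∈ S, c⁻¹ • x ∈ S) {q : ℕ} {x : W}
    (h : IsRegPt S q x) : IsRegPt S q (c • x) := by
  obtain ⟨U, hU, hxU, g, hg, hSU, hsurj⟩ := h
  set θ : W → W := fun x' => c⁻¹ • x' with hθ
  have hθc : Continuous θ := continuous_const_smul _
  have hθx : θ (c • x) = x := by simp [hθ, smul_smul, inv_mul_cancel₀ hc]
  have hθd : ∀ x', HasFDerivAt θ (c⁻¹ • ContinuousLinearMap.id ℂ W) x' := fun x' =>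
    (hasFDerivAt_id x').fun_const_smul c⁻¹
  refine ⟨θ ⁻¹' U, hU.preimage hθc, by rw [mem_preimage, hθx]; exact hxU, g ∘ θ,
    hg.comp (fun x' _ => (hθd x').differentiableAt.differentiableWithinAt) (mapsTo_preimage θ U),
    ?_, ?_⟩
  · ext x'
    constructor
    · rintro ⟨hx'S, hx'U⟩
      have : θ x' ∈ S ∩ U := ⟨hS' x' hx'S, hx'U⟩
      rw [hSU] at this
      exact ⟨hx'U, this.2⟩
    · rintro ⟨hx'U, hgx⟩
      have : θ x' ∈ U ∩ g ⁻¹' {0} := ⟨hx'U, hgx⟩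
      rw [← hSU] at this
      have h1 := hS _ this.1
      simp only [hθ, smul_smul, mul_inv_cancel₀ hc, one_smul] at h1
      exact ⟨h1, hx'U⟩
  · have hgd : DifferentiableAt ℂ g (θ (c • x)) := by
      rw [hθx]; exact hg.differentiableAt (hU.mem_nhds hxU)
    rw [(hgd.hasFDerivAt.comp (c • x) (hθd (c • x))).fderiv, hθx]
    intro w
    obtain ⟨v, hv⟩ := hsurj w
    refine ⟨c • v, ?_⟩
    rw [ContinuousLinearMap.comp_apply, smul_apply, ContinuousLinearMap.id_apply, smul_smul,
      inv_mul_cancel₀ hc, one_smul, hv]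

end SmulModel

/-! ### The limit cone in the manifold `⊤ : Opens V` -/

section Top

variable {Ω : Opens V} (A : Set Ω) {b : V} (hb : b ∈ (Ω : Set V)) {p : ℕ}

/-- The limit cone as a subset of the complex manifold `⊤ : Opens V`. [cite: Chirka1989, §8.1] -/
def limitConeTop : Set (⊤ : Opens V) := ((↑) : (⊤ : Opens V) → V) ⁻¹' limitCone A hb

variable {A hb}

omit [FiniteDimensional ℂ V] in
/-- Membership in `limitConeTop`. [folklore] -/
@[simp] theorem mem_limitConeTop {y : (⊤ : Opens V)} : y ∈ limitConeTop A hb ↔ (y : V) ∈ limitCone A hb :=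
  Iff.rfl

variable (A hb) in
omit [FiniteDimensional ℂ V] in
/-- The image in `V` of `limitConeTop` is the limit cone. [folklore] -/
theorem image_val_limitConeTop :
    ((↑) : (⊤ : Opens V) → V) '' limitConeTop A hb = limitCone A hb := by
  ext v
  constructor
  · rintro ⟨y, hy, rfl⟩; exact hy
  · intro hv; exact ⟨⟨v, trivial⟩, hv, rfl⟩

/-- `limitConeTop` is an analytic subset of `⊤ : Opens V`. [cite: Chirka1989, §8.3 Lemma 1] -/
theorem isAnalyticSet_limitConeTop (hA : IsAnalyticSet 𝓘(ℂ, V) A) (hb : b ∈ (Ω : Set V)) :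
    IsAnalyticSet 𝓘(ℂ, V) (limitConeTop A hb) := by
  intro y
  refine isAnalyticSetAt_of_isZeroSetAt_chartImage (I := 𝓘(ℂ, V)) (x := y)
    (by rw [Opens.extChartAt_source]; trivial) ?_
  rw [Opens.chartImage_eq, Opens.extChartAt_apply, image_val_limitConeTop]
  exact isZeroSetAt_iff_isAnalyticSetAt.2 (isAnalyticSet_limitCone hA hb (y : V))

omit [FiniteDimensional ℂ V] in
/-- `limitConeTop` is closed. [folklore] -/
theorem isClosed_limitConeTop (A : Set Ω) (hb : b ∈ (Ω : Set V)) : IsClosed (limitConeTop A hb) :=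
  (isClosed_limitCone A hb).preimage continuous_subtype_val

/-- Every regular point of `limitConeTop` has codimension `≥ dim V − p`. [cite: Chirka1989, §8.3 Lemma 1] -/
theorem le_codim_limitConeTop (hA : HasPureDim 𝓘(ℂ, V) A p) {y : (⊤ : Opens V)}
    (hy : y ∈ limitConeTop A hb) {c : ℕ} (hc : IsRegularPointOfCodim 𝓘(ℂ, V) (limitConeTop A hb) c y) :
    Module.finrank ℂ V - p ≤ c := by
  have h1 : IsRegPt (limitCone A hb) c (y : V) := by
    have := hc.isRegPt_chartImage (x := y) (by rw [Opens.extChartAt_source]; trivial)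
    rwa [Opens.chartImage_eq, Opens.extChartAt_apply, image_val_limitConeTop] at this
  have := finrank_le_of_isRegPt_limitCone hA hb hy h1
  omega

/-- The dilation `y ↦ c • y` of `⊤ : Opens V`. [folklore] -/
def topSmul (c : ℂ) (y : (⊤ : Opens V)) : (⊤ : Opens V) := ⟨c • (y : V), trivial⟩

omit [FiniteDimensional ℂ V] in
/-- The underlying point of `topSmul`. [folklore] -/
@[simp] theorem coe_topSmul (c : ℂ) (y : (⊤ : Opens V)) : (topSmul c y : V) = c • (y : V) := rfl

omit [FiniteDimensional ℂ V] in
/-- `topSmul` is continuous. [folklore] -/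
theorem continuous_topSmul (c : ℂ) : Continuous (topSmul (V := V) c) :=
  Continuous.subtype_mk (continuous_subtype_val.const_smul c) _

omit [FiniteDimensional ℂ V] in
/-- `topSmul c⁻¹ ∘ topSmul c = id` for `c ≠ 0`. [folklore] -/
theorem topSmul_inv_topSmul {c : ℂ} (hc : c ≠ 0) (y : (⊤ : Opens V)) : topSmul c⁻¹ (topSmul c y) = y := by
  apply Subtype.ext
  simp [smul_smul, inv_mul_cancel₀ hc]

omit [FiniteDimensional ℂ V] in
/-- `limitConeTop` is invariant under dilations by `c ≠ 0`. [cite: Chirka1989, §8.1] -/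
theorem topSmul_mem_limitConeTop {y : (⊤ : Opens V)} (hy : y ∈ limitConeTop A hb) {c : ℂ}
    (hc : c ≠ 0) : topSmul c y ∈ limitConeTop A hb :=
  smul_mem_limitCone hy hc

omit [FiniteDimensional ℂ V] in
/-- **Dilations preserve the regular points of `limitConeTop`, with their codimension.**
[folklore] -/
theorem IsRegularPointOfCodim.topSmul_limitConeTop {y : (⊤ : Opens V)} {q : ℕ}
    (h : IsRegularPointOfCodim 𝓘(ℂ, V) (limitConeTop A hb) q y) {c : ℂ} (hc : c ≠ 0) :
    IsRegularPointOfCodim 𝓘(ℂ, V) (limitConeTop A hb) q (topSmul c y) := by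
  have h1 : IsRegPt (limitCone A hb) q (y : V) := by
    have := h.isRegPt_chartImage (x := y) (by rw [Opens.extChartAt_source]; trivial)
    rwa [Opens.chartImage_eq, Opens.extChartAt_apply, image_val_limitConeTop] at this
  have h2 : IsRegPt (limitCone A hb) q (c • (y : V)) :=
    h1.smul_of_invariant hc (fun x hx => smul_mem_limitCone hx hc)
      (fun x hx => smul_mem_limitCone hx (inv_ne_zero hc))
  refine isRegularPointOfCodim_of_isRegPt_chartImage (I := 𝓘(ℂ, V)) (x := topSmul c y)
    (by rw [Opens.extChartAt_source]; trivial) ?_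
  rw [Opens.chartImage_eq, Opens.extChartAt_apply, image_val_limitConeTop]
  exact h2

omit [FiniteDimensional ℂ V] in
/-- Dilations preserve the regular locus of `limitConeTop`. [folklore] -/
theorem topSmul_mem_regularLocus_limitConeTop {y : (⊤ : Opens V)}
    (hy : y ∈ regularLocus 𝓘(ℂ, V) (limitConeTop A hb)) {c : ℂ} (hc : c ≠ 0) :
    topSmul c y ∈ regularLocus 𝓘(ℂ, V) (limitConeTop A hb) := by
  obtain ⟨hyF, q, hq⟩ := hy
  exact ⟨topSmul_mem_limitConeTop hyF hc, q, hq.topSmul_limitConeTop hc⟩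

end Top

/-! ### The regular part of dimension `p` and the null bad set -/

section Strata

variable {Ω : Opens V} (A : Set Ω) {b : V} (hb : b ∈ (Ω : Set V)) (p : ℕ)

/-- **The regular part `M` of dimension `p`** of the limit cone: regular points of codimension
`dim V − p`. [cite: Chirka1989, §5.2] -/
def limitConeReg : Set (⊤ : Opens V) :=
  regularLocusOfCodim 𝓘(ℂ, V) (limitConeTop A hb) (Module.finrank ℂ V - p)

/-- **The bad set `F ∖ M`** of the limit cone. [folklore] -/
def limitConeBad : Set (⊤ : Opens V) := limitConeTop A hb \ limitConeReg A hb p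

variable {A hb p}

omit [FiniteDimensional ℂ V] in
/-- `M ⊆ F`. [folklore] -/
theorem limitConeReg_subset : limitConeReg A hb p ⊆ limitConeTop A hb :=
  regularLocusOfCodim_subset _ _

omit [FiniteDimensional ℂ V] in
/-- `M ⊆ reg F`. [folklore] -/
theorem limitConeReg_subset_regularLocus :
    limitConeReg A hb p ⊆ regularLocus 𝓘(ℂ, V) (limitConeTop A hb) :=
  regularLocusOfCodim_subset_regularLocus _ _

omit [FiniteDimensional ℂ V] in
/-- Membership in `M`. [folklore] -/
theorem mem_limitConeReg_iff {y : (⊤ : Opens V)} :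
    y ∈ limitConeReg A hb p ↔ y ∈ limitConeTop A hb ∧
      IsRegularPointOfCodim 𝓘(ℂ, V) (limitConeTop A hb) (Module.finrank ℂ V - p) y :=
  mem_regularLocusOfCodim_iff

omit [FiniteDimensional ℂ V] in
/-- `M` is relatively open in `F`: `M = F ∩ O` with `O` open. [cite: Chirka1989, §2.3] -/
theorem limitConeReg_eq_inter_isOpen :
    limitConeReg A hb p = limitConeTop A hb ∩
      {y | IsRegularPointOfCodim 𝓘(ℂ, V) (limitConeTop A hb) (Module.finrank ℂ V - p) y} := by
  ext y; exact mem_limitConeReg_iff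

/-- The bad set is closed. [folklore] -/
theorem isClosed_limitConeBad : IsClosed (limitConeBad A hb p) := by
  have : limitConeBad A hb p = limitConeTop A hb ∩
      {y | IsRegularPointOfCodim 𝓘(ℂ, V) (limitConeTop A hb) (Module.finrank ℂ V - p) y}ᶜ := by
    ext y
    constructor
    · rintro ⟨h1, h2⟩
      exact ⟨h1, fun h3 => h2 (mem_limitConeReg_iff.2 ⟨h1, h3⟩)⟩
    · rintro ⟨h1, h2⟩
      exact ⟨h1, fun h3 => h2 (mem_limitConeReg_iff.1 h3).2⟩
  rw [this]
  exact (isClosed_limitConeTop A hb).inter (isOpen_setOf_isRegularPointOfCodim _ _).isClosed_compl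

omit [InnerProductSpace ℂ V] [FiniteDimensional ℂ V] in
/-- The inclusion of `⊤ : Opens V` in `V` is a closed embedding. [folklore] -/
theorem isClosedEmbedding_val_top : Topology.IsClosedEmbedding ((↑) : (⊤ : Opens V) → V) := by
  have hcl : IsClosed (((⊤ : Opens V)) : Set V) := by simp
  exact hcl.isClosedEmbedding_subtypeVal

/-- The image in `V` of the bad set is closed. [folklore] -/
theorem isClosed_image_limitConeBad : IsClosed (((↑) : (⊤ : Opens V) → V) '' limitConeBad A hb p) :=
  isClosedEmbedding_val_top.isClosedMap _ isClosed_limitConeBad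

omit [FiniteDimensional ℂ V] in
/-- Dilations preserve `M`. [folklore] -/
theorem topSmul_mem_limitConeReg {y : (⊤ : Opens V)} (hy : y ∈ limitConeReg A hb p) {c : ℂ}
    (hc : c ≠ 0) : topSmul c y ∈ limitConeReg A hb p := by
  rw [mem_limitConeReg_iff] at hy ⊢
  exact ⟨topSmul_mem_limitConeTop hy.1 hc, hy.2.topSmul_limitConeTop hc⟩

/-- **The bad set of the limit cone is `𝓗^{2p}`-null**: it consists of singular points of the
analytic set `F` (whose regular points have codimension `≥ dim V − p`,
`IsAnalyticSet.euclideanHausdorffMeasure_image_singularLocus_eq_zero`) and of regular points of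
codimension `c > dim V − p`, which lie in the regular locus of the pure-codimension-`c` analytic set
`cl (reg_c F)` (`hausdorffMeasure_image_regularLocus_eq_zero`). [cite: Chirka1989, §3.7 Cor., §14.1] -/
theorem euclideanHausdorffMeasure_image_limitConeBad_eq_zero [MeasurableSpace V] [BorelSpace V]
    (hA : HasPureDim 𝓘(ℂ, V) A p) :
    (μHE[2 * p] : Measure V) (((↑) : (⊤ : Opens V) → V) '' limitConeBad A hb p) = 0 := by
  classical
  set n := Module.finrank ℂ V with hn
  have hp : p ≤ n := hA.le_finrank
  have hF : IsAnalyticSet 𝓘(ℂ, V) (limitConeTop A hb) := isAnalyticSet_limitConeTop hA.isAnalyticSet hb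
  have hcod : ∀ y c, y ∈ limitConeTop A hb → IsRegularPointOfCodim 𝓘(ℂ, V) (limitConeTop A hb) c y →
      n - p ≤ c := fun y c hy h => le_codim_limitConeTop hA hy h
  -- decomposition of the bad set
  have hsub : limitConeBad A hb p ⊆ singularLocus 𝓘(ℂ, V) (limitConeTop A hb) ∪
      ⋃ c ∈ (Finset.range (n + 1)).filter (fun c => c ≠ n - p),
        regularLocusOfCodim 𝓘(ℂ, V) (limitConeTop A hb) c := by
    intro y hy
    obtain ⟨hyF, hyM⟩ := hy
    by_cases hreg : y ∈ regularLocus 𝓘(ℂ, V) (limitConeTop A hb)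
    · obtain ⟨-, c, hc⟩ := hreg
      have hcn : c ≤ n := hc.le_finrank
      have hcne : c ≠ n - p := fun h => hyM (mem_limitConeReg_iff.2 ⟨hyF, h ▸ hc⟩)
      refine Or.inr (mem_iUnion₂.2 ⟨c, Finset.mem_filter.2 ⟨Finset.mem_range.2 (by omega), hcne⟩,
        mem_regularLocusOfCodim_iff.2 ⟨hyF, hc⟩⟩)
    · exact Or.inl ⟨hyF, hreg⟩
  refine measure_mono_null (image_mono hsub) ?_
  rw [image_union, image_iUnion₂]
  refine measure_union_null ?_ (measure_biUnion_null_iff (Finset.countable_toSet _) |>.2 fun c hc => ?_)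
  · exact hF.euclideanHausdorffMeasure_image_singularLocus_eq_zero (c₀ := n - p) (by omega) hcod
  · obtain ⟨hcn, hcne⟩ := Finset.mem_filter.1 hc
    have hcn' : c ≤ n := Nat.lt_succ_iff.1 (Finset.mem_range.1 hcn)
    rcases (regularLocusOfCodim 𝓘(ℂ, V) (limitConeTop A hb) c).eq_empty_or_nonempty with he | hne
    · rw [he, image_empty, measure_empty]
    · -- `c > n - p`: the stratum lies in the regular locus of its (pure) closure
      obtain ⟨y₀, hy₀⟩ := hne
      have hclt : n - p < c := lt_of_le_of_ne (hcod y₀ c hy₀.1 hy₀.2) (Ne.symm hcne)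
      set S : Set (⊤ : Opens V) := closure (regularLocusOfCodim 𝓘(ℂ, V) (limitConeTop A hb) c) with hS
      have hSc : HasPureCodim 𝓘(ℂ, V) S c :=
        IsAnalyticSet.hasPureCodim_closure_regularLocusOfCodim_holds 𝓘(ℂ, V) (⊤ : Opens V) hF ⟨y₀, hy₀⟩
      have hsubS : regularLocusOfCodim 𝓘(ℂ, V) (limitConeTop A hb) c ⊆ regularLocus 𝓘(ℂ, V) S := by
        intro y hy
        exact ⟨subset_closure hy, c,
          (mem_regularLocusOfCodim_iff.1 hy).2.closure_regularLocusOfCodim (isClosed_limitConeTop A hb)⟩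
      refine measure_mono_null (image_mono hsubS) ?_
      rw [Measure.euclideanHausdorffMeasure_def, Measure.smul_apply, smul_eq_zero]
      refine Or.inr (hausdorffMeasure_image_regularLocus_eq_zero fun y c' hy h => ?_)
      have : c' = c := (h.codim_unique hy (hSc.2.2 y ⟨hy, c', h⟩))
      omega

/-- **`𝓗^{2p}(F ∩ K) < ∞` for compact `K`**: the regular part lies in the pure `p`-dimensional
analytic set `cl M`, to which Lelong's theorem applies
(`Lelong1957_hausdorffMeasure_inter_lt_top_holds`), and the bad set is null.
[cite: Chirka1989, §14.1 Thm.] -/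
theorem euclideanHausdorffMeasure_limitCone_inter_lt_top [MeasurableSpace V] [BorelSpace V]
    (hA : HasPureDim 𝓘(ℂ, V) A p) {K : Set V} (hK : IsCompact K) :
    (μHE[2 * p] : Measure V) (limitCone A hb ∩ K) < ⊤ := by
  set n := Module.finrank ℂ V with hn
  have hp : p ≤ n := hA.le_finrank
  have hF : IsAnalyticSet 𝓘(ℂ, V) (limitConeTop A hb) := isAnalyticSet_limitConeTop hA.isAnalyticSet hb
  have hsplit : limitCone A hb ⊆ ((↑) : (⊤ : Opens V) → V) '' limitConeReg A hb p ∪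
      ((↑) : (⊤ : Opens V) → V) '' limitConeBad A hb p := by
    rw [← image_union, ← image_val_limitConeTop A hb]
    refine image_mono fun y hy => ?_
    by_cases h : y ∈ limitConeReg A hb p
    · exact Or.inl h
    · exact Or.inr ⟨hy, h⟩
  have hbad := euclideanHausdorffMeasure_image_limitConeBad_eq_zero (hb := hb) hA
  rcases (limitConeReg A hb p).eq_empty_or_nonempty with he | hne
  · refine lt_of_le_of_lt (measure_mono ((inter_subset_left).trans hsplit)) ?_
    rw [he, image_empty, empty_union, hbad]
    exact ENNReal.zero_lt_top
  · have hpure : HasPureDim 𝓘(ℂ, V) (closure (limitConeReg A hb p)) p := by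
      have h1 := IsAnalyticSet.hasPureCodim_closure_regularLocusOfCodim_holds 𝓘(ℂ, V) (⊤ : Opens V) hF hne
      have h2 := h1.hasPureDim (by omega)
      have : n - (n - p) = p := by omega
      rwa [this] at h2
    have hLelong := Lelong1957_hausdorffMeasure_inter_lt_top_holds V (⊤ : Opens V) p _ hpure K hK
      (fun _ _ => trivial)
    calc (μHE[2 * p] : Measure V) (limitCone A hb ∩ K)
        ≤ (μHE[2 * p] : Measure V) ((((↑) : (⊤ : Opens V) → V) '' limitConeReg A hb p ∪
            ((↑) : (⊤ : Opens V) → V) '' limitConeBad A hb p) ∩ K) :=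
          measure_mono (inter_subset_inter_left _ hsplit)
      _ ≤ (μHE[2 * p] : Measure V) (((↑) : (⊤ : Opens V) → V) '' limitConeReg A hb p ∩ K) +
            (μHE[2 * p] : Measure V) (((↑) : (⊤ : Opens V) → V) '' limitConeBad A hb p ∩ K) := by
          rw [union_inter_distrib_right]; exact measure_union_le _ _
      _ ≤ (μHE[2 * p] : Measure V) (((↑) : (⊤ : Opens V) → V) '' closure (limitConeReg A hb p) ∩ K) + 0 := by
          gcongr
          · exact subset_closure
          · exact (measure_mono_null inter_subset_left hbad).le
      _ < ⊤ := by rw [add_zero]; exact hLelong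

end Strata

/-! ### The connected components of the regular part: irreducible conic pieces -/

section Components

variable {Ω : Opens V} (A : Set Ω) {b : V} (hb : b ∈ (Ω : Set V)) {p : ℕ}

/-- The connected component of `reg F` through `y`. [cite: Chirka1989, §5.4] -/
def limitConeComp (y : (⊤ : Opens V)) : Set (⊤ : Opens V) :=
  connectedComponentIn (regularLocus 𝓘(ℂ, V) (limitConeTop A hb)) y

/-- The closure of the component through `y`: an irreducible component of `F`. [cite: Chirka1989, §5.4] -/
def limitConeIrr (y : (⊤ : Opens V)) : Set (⊤ : Opens V) := closure (limitConeComp A hb y)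

variable {A hb}

omit [FiniteDimensional ℂ V] in
/-- `y` lies on its component. [folklore] -/
theorem mem_limitConeComp_self {y : (⊤ : Opens V)} (hy : y ∈ limitConeReg A hb p) :
    y ∈ limitConeComp A hb y :=
  mem_connectedComponentIn (limitConeReg_subset_regularLocus hy)

/-- Components through points of `M` lie in `M`. [cite: Chirka1989, §2.3–2.4] -/
theorem limitConeComp_subset_limitConeReg {y : (⊤ : Opens V)} (hy : y ∈ limitConeReg A hb p) :
    limitConeComp A hb y ⊆ limitConeReg A hb p :=
  connectedComponentIn_regularLocus_subset_regularLocusOfCodim hy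

omit [FiniteDimensional ℂ V] in
/-- Components lie in `F`. [folklore] -/
theorem limitConeComp_subset (y : (⊤ : Opens V)) : limitConeComp A hb y ⊆ limitConeTop A hb :=
  (connectedComponentIn_subset _ _).trans (regularLocus_subset _)

omit [FiniteDimensional ℂ V] in
/-- The closure of a component lies in `F`. [folklore] -/
theorem limitConeIrr_subset (y : (⊤ : Opens V)) : limitConeIrr A hb y ⊆ limitConeTop A hb :=
  closure_minimal (limitConeComp_subset y) (isClosed_limitConeTop A hb)

omit [FiniteDimensional ℂ V] in
/-- Two components which meet are equal. [folklore] -/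
theorem limitConeComp_eq_of_mem {y z : (⊤ : Opens V)} (hz : z ∈ limitConeComp A hb y) :
    limitConeComp A hb z = limitConeComp A hb y :=
  (connectedComponentIn_eq hz).symm

/-- **Near a point of a component, `F` IS the component.** [cite: Chirka1989, §5.3 Prop. (proof)] -/
theorem exists_isOpen_limitConeTop_inter_eq {y z : (⊤ : Opens V)} (hz : z ∈ limitConeComp A hb y) :
    ∃ N : Set (⊤ : Opens V), IsOpen N ∧ z ∈ N ∧ limitConeTop A hb ∩ N = limitConeComp A hb y ∩ N := by
  have hzreg : z ∈ regularLocus 𝓘(ℂ, V) (limitConeTop A hb) := connectedComponentIn_subset _ _ hz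
  obtain ⟨N, hNo, hzN, -, hconn, hNreg⟩ := exists_nhds_preconnected_of_mem_regularLocus hzreg univ_mem
  refine ⟨N, hNo, hzN, Subset.antisymm ?_ ?_⟩
  · intro w hw
    refine ⟨?_, hw.2⟩
    rw [← limitConeComp_eq_of_mem hz]
    exact hconn.subset_connectedComponentIn ⟨hzreg.1, hzN⟩ hNreg hw
  · exact inter_subset_inter_left _ (limitConeComp_subset y)

/-- **The closure of another component misses a component**: if `cl C' ∩ C ≠ ∅` then `C' = C`.
[cite: Chirka1989, §5.4 Thm. (1)] -/
theorem limitConeComp_eq_of_limitConeIrr_inter_nonempty {y y' : (⊤ : Opens V)}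
    (h : (limitConeIrr A hb y' ∩ limitConeComp A hb y).Nonempty) :
    limitConeComp A hb y' = limitConeComp A hb y := by
  obtain ⟨z, hzI, hzC⟩ := h
  obtain ⟨N, hNo, hzN, hFN⟩ := exists_isOpen_limitConeTop_inter_eq hzC
  -- `C'` meets `N`, inside `F ∩ N ⊆ C`
  obtain ⟨w, hwN, hwC'⟩ := mem_closure_iff.1 hzI N hNo hzN
  have hwC : w ∈ limitConeComp A hb y := (hFN.subset ⟨limitConeComp_subset y' hwC', hwN⟩).1
  rw [← limitConeComp_eq_of_mem hwC', limitConeComp_eq_of_mem hwC]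

/-- The closure of a component is an irreducible analytic set. [cite: Chirka1989, §5.4 Lemma] -/
theorem isIrreducibleAnalyticSet_limitConeIrr (hA : IsAnalyticSet 𝓘(ℂ, V) A) {y : (⊤ : Opens V)}
    (hy : y ∈ limitConeReg A hb p) : IsIrreducibleAnalyticSet 𝓘(ℂ, V) (limitConeIrr A hb y) :=
  (isAnalyticSet_limitConeTop hA hb).isIrreducibleAnalyticSet_closure_connectedComponentIn
    (limitConeReg_subset_regularLocus hy)

/-- **The closure of a component has pure dimension `p`.** [cite: Chirka1989, §5.3 Cor.] -/
theorem hasPureDim_limitConeIrr (hA : HasPureDim 𝓘(ℂ, V) A p) {y : (⊤ : Opens V)}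
    (hy : y ∈ limitConeReg A hb p) : HasPureDim 𝓘(ℂ, V) (limitConeIrr A hb y) p := by
  set n := Module.finrank ℂ V with hn
  have hp : p ≤ n := hA.le_finrank
  have hirr := isIrreducibleAnalyticSet_limitConeIrr hA.isAnalyticSet hy (hb := hb)
  obtain ⟨c₁, hc₁⟩ := IsIrreducibleAnalyticSet.exists_hasPureCodim_holds 𝓘(ℂ, V) (⊤ : Opens V) hirr
  -- the codimension at `y` is `n - p`
  obtain ⟨hyF, hcy⟩ := mem_limitConeReg_iff.1 hy
  obtain ⟨N, hNo, hyN, hFN⟩ := exists_isOpen_limitConeTop_inter_eq (mem_limitConeComp_self hy)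
  have hYN : limitConeIrr A hb y ∩ N = limitConeTop A hb ∩ N := by
    apply Subset.antisymm (inter_subset_inter_left _ (limitConeIrr_subset y))
    rw [hFN]
    exact inter_subset_inter_left _ subset_closure
  have hyY : IsRegularPointOfCodim 𝓘(ℂ, V) (limitConeIrr A hb y) (n - p) y := hcy.congr_set hNo hyN hYN.symm
  have hyYreg : y ∈ regularLocus 𝓘(ℂ, V) (limitConeIrr A hb y) :=
    ⟨subset_closure (mem_limitConeComp_self hy), _, hyY⟩
  have hc₁eq : c₁ = n - p := (hc₁.2.2 y hyYreg).codim_unique hyYreg.1 hyY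
  rw [hasPureDim_iff hp, ← hc₁eq]
  exact hc₁

omit [FiniteDimensional ℂ V] in
/-- **Components are cones**: `c • z` lies on the component of `z` for `c ≠ 0` (the punctured line
`{c • y : c ≠ 0}` is a connected subset of `reg F` through `y`, and dilations permute components).
[cite: Chirka1989, §8.1] -/
theorem topSmul_mem_limitConeComp {y z : (⊤ : Opens V)} (hz : z ∈ limitConeComp A hb y) {c : ℂ}
    (hc : c ≠ 0) : topSmul c z ∈ limitConeComp A hb y := by
  have hzreg : z ∈ regularLocus 𝓘(ℂ, V) (limitConeTop A hb) := connectedComponentIn_subset _ _ hz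
  -- the punctured line through `z` lies in the component of `z`
  have hline : ∀ c : ℂ, c ≠ 0 → topSmul c z ∈ limitConeComp A hb z := by
    intro c hc
    set f : ℂ → (⊤ : Opens V) := fun c => topSmul c z with hf
    have hfc : Continuous f := Continuous.subtype_mk (continuous_id.smul continuous_const) _
    have hpre : IsPreconnected (f '' ({0}ᶜ : Set ℂ)) :=
      (isConnected_compl_singleton_of_one_lt_rank (by simp [Complex.rank_real_complex]) 0).isPreconnected.image
        f hfc.continuousOn
    have hsub : f '' ({0}ᶜ : Set ℂ) ⊆ regularLocus 𝓘(ℂ, V) (limitConeTop A hb) := by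
      rintro _ ⟨c', hc', rfl⟩
      exact topSmul_mem_regularLocus_limitConeTop hzreg hc'
    have h1 : f 1 ∈ f '' ({0}ᶜ : Set ℂ) := ⟨1, one_ne_zero, rfl⟩
    have hf1 : f 1 = z := Subtype.ext (by simp [hf])
    have := hpre.subset_connectedComponentIn h1 hsub ⟨c, hc, rfl⟩
    rwa [hf1] at this
  -- the dilated component is a connected subset of `reg F` through `c • y'` for some `y'`
  have himage : topSmul c '' limitConeComp A hb y ⊆ limitConeComp A hb y := by
    have hpre : IsPreconnected (topSmul c '' limitConeComp A hb y) :=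
      isPreconnected_connectedComponentIn.image _ (continuous_topSmul c).continuousOn
    have hsub : topSmul c '' limitConeComp A hb y ⊆ regularLocus 𝓘(ℂ, V) (limitConeTop A hb) := by
      rintro _ ⟨w, hw, rfl⟩
      exact topSmul_mem_regularLocus_limitConeTop (connectedComponentIn_subset _ _ hw) hc
    have hcz : topSmul c z ∈ limitConeComp A hb y := limitConeComp_eq_of_mem hz ▸ hline c hc
    have h1 := hpre.subset_connectedComponentIn (mem_image_of_mem _ hz) hsub
    change topSmul c '' limitConeComp A hb y ⊆ limitConeComp A hb (topSmul c z) at h1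
    rwa [limitConeComp_eq_of_mem hcz] at h1
  exact himage ⟨z, hz, rfl⟩

omit [FiniteDimensional ℂ V] in
/-- **The closures of components are cones.** [cite: Chirka1989, §8.1] -/
theorem topSmul_mem_limitConeIrr {y z : (⊤ : Opens V)} (hz : z ∈ limitConeIrr A hb y) {c : ℂ}
    (hc : c ≠ 0) : topSmul c z ∈ limitConeIrr A hb y := by
  have := image_closure_subset_closure_image (continuous_topSmul (V := V) c)
    (s := limitConeComp A hb y) ⟨z, hz, rfl⟩
  exact closure_mono (image_subset_iff.2 fun w hw => topSmul_mem_limitConeComp hw hc) this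

omit [FiniteDimensional ℂ V] in
/-- The vertex `0` lies on the closure of every component. [cite: Chirka1989, §8.1] -/
theorem zero_mem_limitConeIrr {y : (⊤ : Opens V)} (hy : y ∈ limitConeReg A hb p) :
    (⟨0, trivial⟩ : (⊤ : Opens V)) ∈ limitConeIrr A hb y := by
  rw [limitConeIrr, mem_closure_iff_seq_limit]
  refine ⟨fun k => topSmul ((k : ℂ) + 1)⁻¹ y, fun k =>
    topSmul_mem_limitConeComp (mem_limitConeComp_self hy) (inv_ne_zero (by
      exact_mod_cast Nat.succ_ne_zero k)), ?_⟩
  rw [Topology.IsEmbedding.subtypeVal.tendsto_nhds_iff]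
  change Tendsto (fun k : ℕ => ((k : ℂ) + 1)⁻¹ • (y : V)) atTop (𝓝 (0 : V))
  have h1 : Tendsto (fun k : ℕ => ((k : ℂ) + 1)⁻¹) atTop (𝓝 0) := by
    have := tendsto_one_div_add_atTop_nhds_zero_nat (𝕜 := ℂ)
    simpa [one_div] using this
  simpa using h1.smul_const (y : V)

omit [FiniteDimensional ℂ V] in
/-- **Every component meets the closed unit ball** (it is a cone). [folklore] -/
theorem limitConeComp_inter_nonempty {y : (⊤ : Opens V)} (hy : y ∈ limitConeReg A hb p) :
    (limitConeComp A hb y ∩ ((↑) : (⊤ : Opens V) → V) ⁻¹' closedBall (0 : V) 1).Nonempty := by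
  set c : ℂ := ((‖(y : V)‖ + 1 : ℝ) : ℂ)⁻¹ with hc
  have hpos : (0 : ℝ) < ‖(y : V)‖ + 1 := by positivity
  have hc0 : c ≠ 0 := inv_ne_zero (by rw [Ne, Complex.ofReal_eq_zero]; exact hpos.ne')
  refine ⟨topSmul c y, topSmul_mem_limitConeComp (mem_limitConeComp_self hy) hc0, ?_⟩
  rw [mem_preimage, mem_closedBall, dist_zero_right, coe_topSmul, norm_smul, hc, norm_inv,
    Complex.norm_real, Real.norm_of_nonneg hpos.le, inv_mul_le_iff₀ hpos]
  linarith

/-- **There are finitely many components of the regular part of the limit cone**: each meets the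
compact unit ball of `⊤`, which meets only finitely many components of `reg F`
([Chirka1989, §5.1 Thm. (1)], discharged). [cite: Chirka1989, §5.1 Thm. (1)] -/
theorem finite_setOf_limitConeComp (hA : IsAnalyticSet 𝓘(ℂ, V) A) :
    {C : Set (⊤ : Opens V) | ∃ y ∈ limitConeReg A hb p, C = limitConeComp A hb y}.Finite := by
  have hK : IsCompact (((↑) : (⊤ : Opens V) → V) ⁻¹' closedBall (0 : V) 1) :=
    isClosedEmbedding_val_top.isCompact_preimage (isCompact_closedBall 0 1)
  refine (IsAnalyticSet.finite_connectedComponentIn_regularLocus_inter_compact_holds 𝓘(ℂ, V)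
    (⊤ : Opens V) (isAnalyticSet_limitConeTop hA hb) hK).subset ?_
  rintro C ⟨y, hy, rfl⟩
  exact ⟨⟨y, limitConeReg_subset_regularLocus hy, rfl⟩, limitConeComp_inter_nonempty hy⟩

/-- The regular part is the union of its (finitely many) components. [folklore] -/
theorem limitConeReg_eq_biUnion :
    limitConeReg A hb p = ⋃ y ∈ limitConeReg A hb p, limitConeComp A hb y :=
  Subset.antisymm (fun _ hy => mem_biUnion hy (mem_limitConeComp_self hy))
    (iUnion₂_subset fun _ hy => limitConeComp_subset_limitConeReg hy)

end Components

end Literature.Geometry.Kaehler
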